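import Mathlib
import Summits.NavierStokesRegularity.NavierStokesRegularity.Theorems.OddMorawetzMorawetzKillsTypeIWeightParity
import HarnessLib

/-!
# Crux `OddMorawetz.OddMorawetzLocal` (stmt-NavierStokesRegularity-1376), line `registered`
  (refutation skeleton): stub `cubicWeightSplit` — the weight-`k` part of a cubic jet form

A smooth density `m` on 3-jets `z = (z₀, z₁, z₂, z₃) ∈ E₀ × F₁ × F₂ × F₃` which is a cubic form
(`m (μ • z) = μ ^ 3 * m z` for all real `μ`) and has derivative weight `k` under the positive
dilations `(z₀, s • z₁, s² • z₂, s³ • z₃)` is an explicit polynomial in the jet: writing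
`z = ∑ⱼ ιⱼ z` with `ιⱼ z` the `j`-th component of `z` placed in slot `j`, and `D³m(0)` for the
third Fréchet derivative at the origin,

  `6 * m z = ∑_{a + b + c = k} D³m(0)[ι_a z, ι_b z, ι_c z]`   (`cubic_weightSplit`).

Proof.  `6 * m z = D³m(0)[z, z, z]` (`six_mul_eq_iteratedFDeriv_of_cubic`, tree).  Expanding the
trilinear form slot by slot along the dilated jet `∑ⱼ s ^ j • ιⱼ z` shows that
`s ↦ 6 * m (z₀, s • z₁, s² • z₂, s³ • z₃)` is the real polynomial
`∑_{a,b,c} D³m(0)[ι_a z, ι_b z, ι_c z] · s ^ (a + b + c)`; by the weight hypothesis it agrees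
with `s ^ k * 6 * m z` on the infinite set `(0, ∞)`, so the two polynomials coincide
(`Polynomial.eq_zero_of_infinite_isRoot`) and comparing the coefficients of `s ^ k` gives the
claim.

Elementary; no named facts, Mathlib only (plus the tree lemma quoted above).
Lands `--supports stmt-NavierStokesRegularity-1376`.
-/

noncomputable section

-- the summit and its single problem share the name (D-0017 nested layout)
set_option linter.dupNamespace false

namespace Summit.NavierStokesRegularity.NavierStokesRegularity.Theorems

open Polynomial

/-- Slot-wise linearity of a continuous trilinear form written in `![·, ·, ·]` notation, first
slot: `T ![∑ₐ cₐ • fₐ, y, w] = ∑ₐ cₐ * T ![fₐ, y, w]`. -/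
theorem map_vec3_sum_smul_fst {V : Type*} [NormedAddCommGroup V] [NormedSpace ℝ V]
    (T : ContinuousMultilinearMap ℝ (fun _ : Fin 3 => V) ℝ) {α : Type*} [Fintype α]
    (c : α → ℝ) (f : α → V) (y w : V) :
    T ![∑ a, c a • f a, y, w] = ∑ a, c a * T ![f a, y, w] := by
  have hu : ∀ x : V, (![x, y, w] : Fin 3 → V) = Function.update ![(0 : V), y, w] 0 x := by
    intro x; funext j; fin_cases j <;> simp
  have hL : ∀ x : V, T ![x, y, w] = T.toContinuousLinearMap ![(0 : V), y, w] 0 x := by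
    intro x; rw [hu x]; rfl
  rw [hL, map_sum]
  exact Finset.sum_congr rfl fun a _ => by rw [map_smul, smul_eq_mul, ← hL]

/-- Slot-wise linearity of a continuous trilinear form written in `![·, ·, ·]` notation, second
slot: `T ![x, ∑ₐ cₐ • fₐ, w] = ∑ₐ cₐ * T ![x, fₐ, w]`. -/
theorem map_vec3_sum_smul_snd {V : Type*} [NormedAddCommGroup V] [NormedSpace ℝ V]
    (T : ContinuousMultilinearMap ℝ (fun _ : Fin 3 => V) ℝ) {α : Type*} [Fintype α]
    (c : α → ℝ) (f : α → V) (x w : V) :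
    T ![x, ∑ a, c a • f a, w] = ∑ a, c a * T ![x, f a, w] := by
  have hu : ∀ y : V, (![x, y, w] : Fin 3 → V) = Function.update ![x, (0 : V), w] 1 y := by
    intro y; funext j; fin_cases j <;> simp
  have hL : ∀ y : V, T ![x, y, w] = T.toContinuousLinearMap ![x, (0 : V), w] 1 y := by
    intro y; rw [hu y]; rfl
  rw [hL, map_sum]
  exact Finset.sum_congr rfl fun a _ => by rw [map_smul, smul_eq_mul, ← hL]

/-- Slot-wise linearity of a continuous trilinear form written in `![·, ·, ·]` notation, third
slot: `T ![x, y, ∑ₐ cₐ • fₐ] = ∑ₐ cₐ * T ![x, y, fₐ]`. -/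
theorem map_vec3_sum_smul_thd {V : Type*} [NormedAddCommGroup V] [NormedSpace ℝ V]
    (T : ContinuousMultilinearMap ℝ (fun _ : Fin 3 => V) ℝ) {α : Type*} [Fintype α]
    (c : α → ℝ) (f : α → V) (x y : V) :
    T ![x, y, ∑ a, c a • f a] = ∑ a, c a * T ![x, y, f a] := by
  have hu : ∀ w : V, (![x, y, w] : Fin 3 → V) = Function.update ![x, y, (0 : V)] 2 w := by
    intro w; funext j; fin_cases j <;> simp
  have hL : ∀ w : V, T ![x, y, w] = T.toContinuousLinearMap ![x, y, (0 : V)] 2 w := by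
    intro w; rw [hu w]; rfl
  rw [hL, map_sum]
  exact Finset.sum_congr rfl fun a _ => by rw [map_smul, smul_eq_mul, ← hL]

/-- Full trilinear expansion of a continuous trilinear form on the diagonal of a weighted sum:
`T (x, x, x)` with `x = ∑ₐ cₐ • fₐ` equals `∑_{a,b,d} T ![fₐ, f_b, f_d] * (cₐ c_b c_d)`. -/
theorem map_const_sum_smul_three {V : Type*} [NormedAddCommGroup V] [NormedSpace ℝ V]
    (T : ContinuousMultilinearMap ℝ (fun _ : Fin 3 => V) ℝ) {α : Type*} [Fintype α]
    (c : α → ℝ) (f : α → V) :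
    T (fun _ => ∑ a, c a • f a) = ∑ a, ∑ b, ∑ d, T ![f a, f b, f d] * (c a * c b * c d) := by
  have h3 : (fun _ : Fin 3 => ∑ a, c a • f a)
      = ![∑ a, c a • f a, ∑ a, c a • f a, ∑ a, c a • f a] := by
    funext j; fin_cases j <;> rfl
  rw [h3, map_vec3_sum_smul_fst]
  refine Finset.sum_congr rfl fun a _ => ?_
  rw [map_vec3_sum_smul_snd, Finset.mul_sum]
  refine Finset.sum_congr rfl fun b _ => ?_
  rw [map_vec3_sum_smul_thd, Finset.mul_sum, Finset.mul_sum]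
  refine Finset.sum_congr rfl fun d _ => ?_
  ring

/-- **Weight-`k` part of a cubic jet form** (stub `cubicWeightSplit` of the refutation skeleton of
the crux `OddMorawetz.OddMorawetzLocal`).  A smooth function `m` on `E₀ × F₁ × F₂ × F₃` which is a
cubic form for every real scalar (`m (μ • z) = μ ^ 3 * m z`) and has weight `k` under the dilations
`(z₀, s • z₁, s² • z₂, s³ • z₃)`, `s > 0`, is the weight-`k` part of its cubic form:
`6 * m z = ∑_{a + b + c = k} D³m(0)[ι_a z, ι_b z, ι_c z]`, where `ι_j z` is the `j`-th component of
`z` placed in slot `j` (the four vectors of the `![…]` list).  Proof: `six_mul_eq_iteratedFDeriv_of_cubic`,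
trilinear expansion of `z = ∑ⱼ ιⱼ z` along the dilated jet (`map_const_sum_smul_three`), and
comparison of the coefficient of `s ^ k` of two real polynomials that agree on `(0, ∞)`
(`Polynomial.eq_zero_of_infinite_isRoot`). -/
theorem cubic_weightSplit {E₀ F₁ F₂ F₃ : Type*}
    [NormedAddCommGroup E₀] [NormedSpace ℝ E₀] [NormedAddCommGroup F₁] [NormedSpace ℝ F₁]
    [NormedAddCommGroup F₂] [NormedSpace ℝ F₂] [NormedAddCommGroup F₃] [NormedSpace ℝ F₃]
    (k : ℕ) {m : E₀ × F₁ × F₂ × F₃ → ℝ} (hm : ContDiff ℝ (⊤ : ℕ∞) m)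
    (hcub : ∀ (μ : ℝ) (z : E₀ × F₁ × F₂ × F₃), m (μ • z) = μ ^ 3 * m z)
    (hwt : ∀ s : ℝ, 0 < s → ∀ (z₀ : E₀) (z₁ : F₁) (z₂ : F₂) (z₃ : F₃),
      m (z₀, s • z₁, (s ^ 2) • z₂, (s ^ 3) • z₃) = s ^ k * m (z₀, z₁, z₂, z₃))
    (z : E₀ × F₁ × F₂ × F₃) :
    6 * m z = ∑ a : Fin 4, ∑ b : Fin 4, ∑ c : Fin 4,
      if a.val + b.val + c.val = k then
        iteratedFDeriv ℝ 3 m 0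
          ![(![((z.1, 0, 0, 0) : E₀ × F₁ × F₂ × F₃), (0, z.2.1, 0, 0), (0, 0, z.2.2.1, 0), (0, 0, 0, z.2.2.2)] a),
            (![((z.1, 0, 0, 0) : E₀ × F₁ × F₂ × F₃), (0, z.2.1, 0, 0), (0, 0, z.2.2.1, 0), (0, 0, 0, z.2.2.2)] b),
            (![((z.1, 0, 0, 0) : E₀ × F₁ × F₂ × F₃), (0, z.2.1, 0, 0), (0, 0, z.2.2.1, 0), (0, 0, 0, z.2.2.2)] c)]
      else 0 := by
  classical
  -- the four "pure" jets `e = ![(z₀,0,0,0), (0,z₁,0,0), (0,0,z₂,0), (0,0,0,z₃)]`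
  set e : Fin 4 → E₀ × F₁ × F₂ × F₃ :=
    ![((z.1, 0, 0, 0) : E₀ × F₁ × F₂ × F₃), (0, z.2.1, 0, 0), (0, 0, z.2.2.1, 0), (0, 0, 0, z.2.2.2)]
    with he
  set T := iteratedFDeriv ℝ 3 m 0 with hT
  -- the dilated jet is the weighted sum `∑ₐ s ^ a • e a`
  have hw : ∀ s : ℝ, ((z.1, s • z.2.1, (s ^ 2) • z.2.2.1, (s ^ 3) • z.2.2.2) : E₀ × F₁ × F₂ × F₃)
      = ∑ a : Fin 4, s ^ (a : ℕ) • e a := by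
    intro s
    simp [he, Fin.sum_univ_four]
  -- the polynomial `P (s) = 6 * m (dilated jet)`
  set P : ℝ[X] := ∑ a : Fin 4, ∑ b : Fin 4, ∑ c : Fin 4,
      C (T ![e a, e b, e c]) * X ^ ((a : ℕ) + b + c) with hP
  have hPeval : ∀ s : ℝ, T (fun _ => ∑ a : Fin 4, s ^ (a : ℕ) • e a) = P.eval s := by
    intro s
    rw [map_const_sum_smul_three]
    simp only [hP, eval_finsetSum, eval_mul, eval_C, eval_pow, eval_X, pow_add]
  have hmw : ∀ s : ℝ, 6 * m (z.1, s • z.2.1, (s ^ 2) • z.2.2.1, (s ^ 3) • z.2.2.2) = P.eval s := by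
    intro s
    rw [six_mul_eq_iteratedFDeriv_of_cubic hm hcub, hw s, hPeval s]
  -- `P - C (6 * m z) * X ^ k` vanishes on `(0, ∞)`, hence it is the zero polynomial
  have hq : P - C (6 * m z) * X ^ k = 0 := by
    apply Polynomial.eq_zero_of_infinite_isRoot
    refine (Set.Ioi_infinite (0 : ℝ)).mono fun s hs => ?_
    have h1 := hmw s
    rw [hwt s hs] at h1
    simp only [Set.mem_setOf_eq, IsRoot.def, eval_sub, eval_mul, eval_C, eval_pow, eval_X]
    linear_combination -h1
  -- compare the coefficients of `X ^ k`
  have hk := congrArg (fun q : ℝ[X] => q.coeff k) hq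
  simp only [hP, coeff_sub, finsetSum_coeff, coeff_C_mul, coeff_X_pow, coeff_zero, if_true,
    mul_one, sub_eq_zero] at hk
  rw [← hk]
  refine Finset.sum_congr rfl fun a _ => Finset.sum_congr rfl fun b _ =>
    Finset.sum_congr rfl fun c _ => ?_
  by_cases h : (a : ℕ) + b + c = k
  · rw [if_pos h, if_pos h.symm, mul_one]
  · rw [if_neg h, if_neg (fun h' => h h'.symm), mul_zero]
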